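import Literature.NumberTheory.Rogawski1990.SingularObstruction
import Literature.NumberTheory.QuadraticForms.HermitianCongruenceOfLocalNorms
import HarnessLib

/-!
# The archimedean sign of a principal adelic norm class `δ = (k ⊗ 1) · σ_𝔸(z) z`: at every complex place `w` of the CM field,
# `Re δ_w = τ_w(k) · |z_w|²` — so `k ∈ L⁺` carries the SIGNS of `δ_∞`, and `δ_∞ > 0` forces `k` totally positive
# (Rogawski 1990, §3.3 Prop. 3.3.1, §3.8 Prop. 3.8.1 (d): the archimedean part of Kottwitz's obstruction at a singular class)

Topic `NumberTheory/Rogawski1990`; namespace `Literature.NumberTheory.Rogawski1990`; **THEOREMS ONLY** (no definition, no named fact, no instance,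
no notation, no `sorry`).  Cell `pub/hodgecm-mathlib`, ENGINE T1 (crux H413 = `stmt-HodgeConjecture-24833`), O7 «singular semisimple classes», piece
**(h4)(ii) «POSITIVITY ∕ CURRENCY BRIDGE»** of the `hreal` assembly for ★ `singularObs` (TRUNK WORDS #7 ∕ O7 OWNER WORD #12 (2); socket F0P5a-p03
09:55:02Z), in the letters of ★ `IsPrincipalAdelicNorm` (`SingularObstruction`) and of the archimedean projection
`π_∞ := ringEquiv_mixedSpace ∘ adeleFst : 𝔸_L →+* L ⊗ ℝ = mixedSpace L` used by ★ P5″ `obsHasse_of_placewise`.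

THE MATHEMATICS.  `L` CM, `σ` = complex conjugation (`cmConjRingHom L`, on adèles ★ `adeleConj L = σ ⊗ 1`).  Every infinite place `w` of `L` is complex
and FIXED by `σ` (★ `complexConj_smul_infinitePlace`), and `σ ⊗ 1` acts on the `w`-coordinate of `L ⊗ ℝ` by complex conjugation
(★ `conjMixed_snd_self` + ★ `conjCoord_eq_conj`).  Hence for `z ∈ 𝔸_L`: `(σ_𝔸 z · z)_w = conj(z_w) · z_w = |z_w|²` (§1
`snd_archProj_adeleConj_mul_self`), a non-negative real, positive when `z` is a unit; and for `k ∈ L⁺`: `(k ⊗ 1)_w = τ_w(k) ∈ ℝ`.  So for a principal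
adelic norm class `δ = (k ⊗ 1) · σ_𝔸(z) · z` (★ `IsPrincipalAdelicNorm L δ`): **`Re δ_w = Re τ_w(k) · |z_w|²`** (§2 `re_snd_archProj_eq_of_isPrincipalAdelicNorm`),
i.e. THE SIGN OF `δ` AT `w` IS THE SIGN OF `k` AT `w` (`re_snd_archProj_pos_iff`) — the general (h4′) bookkeeping of TRUNK WORDS #8 (F2) — and if
`Re δ_w > 0` at every `w` then `k` is TOTALLY POSITIVE, `Re τ(k) > 0` for every complex embedding `τ` (§3
**`exists_totallyPositive_of_isPrincipalAdelicNorm`** = the (h4) socket: `∃ k z, k ≠ 0 ∧ σ k = k ∧ (∀ τ, 0 < Re τ(k)) ∧ δ = (k ⊗ 1)·σ_𝔸(z)·z`),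
which is the `ξ ≫ 0` that ★ `exists_commute_hermStar_eq_of_frame` ((R6a-s)) consumes.

HONEST LABEL: archimedean bookkeeping only; (h4)(i) — positivity of ★ `adelicBlockDet` at `∞` for a (totally) definite `H` — is NOT in this file (it
waits for the O7 owner's rule on TRUNK WORDS #8 (F2)); nothing printed is consumed; HC_CM is proved only modulo the printed citations until rung 0 closes.

## References
* [Rogawski1990] J. D. Rogawski, *Automorphic Representations of Unitary Groups in Three Variables*, Ann. of Math. Stud. 123 (1990), §3.3 Prop. 3.3.1
  p. 22 (local conditions at the archimedean places), §3.8 Prop. 3.8.1 (d) p. 27.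
* [BorelJacquet1979] A. Borel, H. Jacquet, PSPM 33.1 (1979), §4.1 (`G(L ⊗ ℝ) = ∏_{w∣∞} G(L_w)`, the archimedean projection).
-/

set_option autoImplicit false

noncomputable section

open NumberField NumberField.InfinitePlace NumberField.mixedEmbedding IsDedekindDomain
open scoped ComplexConjugate

namespace Literature.NumberTheory.Rogawski1990

open Literature.NumberTheory.Automorphic
open Literature.NumberTheory.Automorphic.UnitaryGroup (conjMixed conjCoord adeleFst)
open Literature.NumberTheory.QuadraticForms

variable (L : Type) [Field L] [NumberField L] [IsCMField L]

/-! ## §1 The `w`-coordinate of `σ_𝔸(z) · z` is `|z_w|²` -/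

omit [IsCMField L] in
/-- The archimedean projection of an adèle, complex coordinate: `(π_∞ x)_w = ι_w(x_w)` (definitional). [cite: BorelJacquet1979, §4.1] -/
theorem snd_archProj_apply (x : AdeleRing (𝓞 L) L) (w : {w : InfinitePlace L // IsComplex w}) :
    (((InfiniteAdeleRing.ringEquiv_mixedSpace L).toRingHom.comp (adeleFst L)) x).2 w = Completion.extensionEmbedding w.1 (x.1 w.1) := rfl

/-- **`(σ_𝔸 x)_w = conj (x_w)`**: on the CM field every infinite place is complex and fixed by `σ`, and `σ ⊗ 1` acts on the `w`-coordinate of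
`L ⊗ ℝ` by complex conjugation (★ `ringEquiv_mixedSpace_fst_adeleConj`, ★ `conjMixed_snd_self`, ★ `conjCoord_eq_conj`).
[cite: Rogawski1990, §3.3 Prop. 3.3.1 p. 22] [cite: BorelJacquet1979, §4.1] -/
theorem snd_archProj_adeleConj (x : AdeleRing (𝓞 L) L) (w : {w : InfinitePlace L // IsComplex w}) :
    (((InfiniteAdeleRing.ringEquiv_mixedSpace L).toRingHom.comp (adeleFst L)) (adeleConj L x)).2 w =
      conj ((((InfiniteAdeleRing.ringEquiv_mixedSpace L).toRingHom.comp (adeleFst L)) x).2 w) := by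
  have hw : IsCMField.complexConj L • w.1 = w.1 := UnitaryGroup.complexConj_smul_infinitePlace L w.1
  change (InfiniteAdeleRing.ringEquiv_mixedSpace L (adeleConj L x).1).2 w = conj ((InfiniteAdeleRing.ringEquiv_mixedSpace L x.1).2 w)
  rw [ringEquiv_mixedSpace_fst_adeleConj, UnitaryGroup.conjMixed_snd_self hw,
    UnitaryGroup.conjCoord_eq_conj (↥(maximalRealSubfield L)) L (IsCMField.complexConj L) hw (IsCMField.complexConj_ne_one L)]

/-- **`(σ_𝔸 z · z)_w = conj(z_w) · z_w = |z_w|²`.** [cite: Rogawski1990, §3.3 Prop. 3.3.1 p. 22] -/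
theorem snd_archProj_adeleConj_mul_self (z : AdeleRing (𝓞 L) L) (w : {w : InfinitePlace L // IsComplex w}) :
    (((InfiniteAdeleRing.ringEquiv_mixedSpace L).toRingHom.comp (adeleFst L)) (adeleConj L z * z)).2 w =
      (Complex.normSq ((((InfiniteAdeleRing.ringEquiv_mixedSpace L).toRingHom.comp (adeleFst L)) z).2 w) : ℂ) := by
  rw [map_mul, Prod.snd_mul, Pi.mul_apply, snd_archProj_adeleConj, Complex.normSq_eq_conj_mul_self]

omit [IsCMField L] in
/-- For a UNIT `z` of `𝔸_L` the `w`-coordinate `z_w` is non-zero. [cite: BorelJacquet1979, §4.1] -/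
theorem snd_archProj_ne_zero_of_isUnit {z : AdeleRing (𝓞 L) L} (hz : IsUnit z) (w : {w : InfinitePlace L // IsComplex w}) :
    (((InfiniteAdeleRing.ringEquiv_mixedSpace L).toRingHom.comp (adeleFst L)) z).2 w ≠ 0 := by
  obtain ⟨u, rfl⟩ := hz
  have h := congrArg (fun m : mixedSpace L => m.2 w)
    ((((InfiniteAdeleRing.ringEquiv_mixedSpace L).toRingHom.comp (adeleFst L))).map_mul (u⁻¹ : (AdeleRing (𝓞 L) L)ˣ) u)
  simp only [Units.inv_mul, map_one, Prod.snd_one, Pi.one_apply, Prod.snd_mul, Pi.mul_apply] at h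
  exact right_ne_zero_of_mul_eq_one h.symm

omit [IsCMField L] in
/-- **The principal part at a complex place**: `(k ⊗ 1)_w = τ_w(k)` (for `k ∈ L⁺` this is real: `conj τ_w(k) = τ_w(σ k) = τ_w(k)`).
[cite: Rogawski1990, §3.3 Prop. 3.3.1 p. 22] -/
theorem snd_archProj_algebraMap (k : L) (w : {w : InfinitePlace L // IsComplex w}) :
    (((InfiniteAdeleRing.ringEquiv_mixedSpace L).toRingHom.comp (adeleFst L)) (algebraMap L (AdeleRing (𝓞 L) L) k)).2 w = w.1.embedding k := by
  change (InfiniteAdeleRing.ringEquiv_mixedSpace L (algebraMap L (AdeleRing (𝓞 L) L) k).1).2 w = _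
  rw [ringEquiv_mixedSpace_fst_algebraMap, mixedEmbedding_apply_isComplex]

/-- `Re (τ(k) · u) = Re τ(k) · Re u` for `σ`-fixed `k` (then `τ k` is real). [folklore] -/
private theorem re_embedding_mul_of_isReal {k : L} (hk : cmConjRingHom L k = k) (τ : L →+* ℂ) (u : ℂ) :
    (τ k * u).re = (τ k).re * u.re := by
  have hreal : conj (τ k) = τ k := by
    rw [← IsCMField.complexEmbedding_complexConj (K := L) τ k]
    exact congrArg τ hk
  have him : (τ k).im = 0 := by
    have := congrArg Complex.im hreal
    rw [Complex.conj_im] at this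
    linarith
  rw [Complex.mul_re, him, zero_mul, sub_zero]

/-! ## §2 The sign of a principal adelic norm class at a complex place is the sign of its principal part -/

/-- **`Re δ_w = Re τ_w(k) · |z_w|²`** for `δ = (k ⊗ 1) · σ_𝔸(z) · z` with `σ k = k`. [cite: Rogawski1990, §3.3 Prop. 3.3.1 p. 22; §3.8 Prop. 3.8.1 (d) p. 27] -/
theorem re_snd_archProj_eq_of_eq_mul_adeleConj_mul {δ : AdeleRing (𝓞 L) L} {k : L} {z : AdeleRing (𝓞 L) L} (hk : cmConjRingHom L k = k)
    (hδ : δ = algebraMap L (AdeleRing (𝓞 L) L) k * (adeleConj L z * z)) (w : {w : InfinitePlace L // IsComplex w}) :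
    ((((InfiniteAdeleRing.ringEquiv_mixedSpace L).toRingHom.comp (adeleFst L)) δ).2 w).re =
      (w.1.embedding k).re * Complex.normSq ((((InfiniteAdeleRing.ringEquiv_mixedSpace L).toRingHom.comp (adeleFst L)) z).2 w) := by
  rw [hδ, map_mul, Prod.snd_mul, Pi.mul_apply, snd_archProj_algebraMap, snd_archProj_adeleConj_mul_self,
    re_embedding_mul_of_isReal L hk, Complex.ofReal_re]

/-- **(h4′) SIGN BOOKKEEPING**: for `δ = (k ⊗ 1) · σ_𝔸(z) · z` with `σ k = k` and `z` a unit, `Re δ_w > 0 ↔ Re τ_w(k) > 0` at every complex place `w`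
— the sign of the block-determinant class at `w` is the sign of its global representative `k` at `w`. [cite: Rogawski1990, §3.3 Prop. 3.3.1 p. 22; §3.8 Prop. 3.8.1 (d) p. 27] -/
theorem re_snd_archProj_pos_iff {δ : AdeleRing (𝓞 L) L} {k : L} {z : AdeleRing (𝓞 L) L} (hk : cmConjRingHom L k = k) (hz : IsUnit z)
    (hδ : δ = algebraMap L (AdeleRing (𝓞 L) L) k * (adeleConj L z * z)) (w : {w : InfinitePlace L // IsComplex w}) :
    0 < ((((InfiniteAdeleRing.ringEquiv_mixedSpace L).toRingHom.comp (adeleFst L)) δ).2 w).re ↔ 0 < (w.1.embedding k).re := by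
  have hn : 0 < Complex.normSq ((((InfiniteAdeleRing.ringEquiv_mixedSpace L).toRingHom.comp (adeleFst L)) z).2 w) :=
    Complex.normSq_pos.2 (snd_archProj_ne_zero_of_isUnit L hz w)
  rw [re_snd_archProj_eq_of_eq_mul_adeleConj_mul L hk hδ w]
  exact ⟨fun h => pos_of_mul_pos_left h hn.le, fun h => mul_pos h hn⟩

/-- From infinite places to ALL complex embeddings: `Re τ(k) > 0` for every `τ : L →+* ℂ` as soon as `Re τ_w(k) > 0` at every complex place `w`
(`τ` is `τ_w` or its conjugate for `w = mk τ`; the CM field has no real place). [cite: Rogawski1990, §3.3 Prop. 3.3.1 p. 22] -/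
theorem forall_re_embedding_pos_of_forall_place {k : L} (h : ∀ w : {w : InfinitePlace L // IsComplex w}, 0 < (w.1.embedding k).re)
    (τ : L →+* ℂ) : 0 < (τ k).re := by
  have hc : (InfinitePlace.mk τ).IsComplex := InfinitePlace.not_isReal_iff_isComplex.1 fun hr =>
    InfinitePlace.not_isReal_iff_isComplex.2 (IsTotallyComplex.isComplex (InfinitePlace.mk τ)) hr
  have h' := h ⟨InfinitePlace.mk τ, hc⟩
  rcases InfinitePlace.embedding_mk_eq τ with he | he
  · rwa [show (InfinitePlace.mk τ).embedding = τ from he] at h'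
  · rw [show (InfinitePlace.mk τ).embedding = ComplexEmbedding.conjugate τ from he, ComplexEmbedding.conjugate_coe_eq, Complex.conj_re] at h'
    exact h'

/-! ## §3 The (h4) socket: a principal adelic norm class positive at `∞` has a TOTALLY POSITIVE principal part -/

variable {L}

/-- **(h4)(ii) A PRINCIPAL ADELIC NORM CLASS WITH POSITIVE ARCHIMEDEAN COMPONENTS HAS A TOTALLY POSITIVE PRINCIPAL PART.**  If `δ ∈ 𝔸_L` is a principal
adelic norm (★ `IsPrincipalAdelicNorm L δ`: `δ = (k ⊗ 1) · σ_𝔸(z) · z`, `k ∈ L⁺ ∖ 0`, `z ∈ 𝔸_Lˣ`) and `Re δ_w > 0` at every complex place `w` (the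
`w`-coordinate of `π_∞ δ`, `π_∞ = ringEquiv_mixedSpace ∘ adeleFst`), then its principal part is TOTALLY POSITIVE: `Re τ(k) > 0` for every complex
embedding `τ` of `L` — the `ξ ≫ 0` feeding ★ `exists_commute_hermStar_eq_of_frame` in the P5″ `hreal` assembly at a singular class of a totally
definite `U(H)`. [cite: Rogawski1990, §3.3 Prop. 3.3.1 p. 22; §3.8 Prop. 3.8.1 (d) p. 27] -/
theorem exists_totallyPositive_of_isPrincipalAdelicNorm {δ : AdeleRing (𝓞 L) L} (hδ : IsPrincipalAdelicNorm L δ)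
    (hpos : ∀ w : {w : InfinitePlace L // IsComplex w}, 0 < ((((InfiniteAdeleRing.ringEquiv_mixedSpace L).toRingHom.comp (adeleFst L)) δ).2 w).re) :
    ∃ (k : L) (z : (AdeleRing (𝓞 L) L)ˣ), k ≠ 0 ∧ cmConjRingHom L k = k ∧ (∀ τ : L →+* ℂ, 0 < (τ k).re) ∧
      δ = algebraMap L (AdeleRing (𝓞 L) L) k * (adeleConj L (z : AdeleRing (𝓞 L) L) * (z : AdeleRing (𝓞 L) L)) := by
  obtain ⟨k, z, hk0, hk, hδ⟩ := hδ
  refine ⟨k, z, hk0, hk, forall_re_embedding_pos_of_forall_place L fun w => ?_, hδ⟩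
  exact (re_snd_archProj_pos_iff L hk z.isUnit hδ w).1 (hpos w)

/-- The same with the signs READ OFF place by place (general, for a possibly indefinite `H` — TRUNK WORDS #8 (F2) (h4′)): the principal part `k` of a
principal adelic norm class `δ` satisfies `Re τ_w(k) > 0 ↔ Re δ_w > 0` at every complex place `w`. [cite: Rogawski1990, §3.3 Prop. 3.3.1 p. 22; §3.8 Prop. 3.8.1 (d) p. 27] -/
theorem exists_sign_eq_of_isPrincipalAdelicNorm {δ : AdeleRing (𝓞 L) L} (hδ : IsPrincipalAdelicNorm L δ) :
    ∃ (k : L) (z : (AdeleRing (𝓞 L) L)ˣ), k ≠ 0 ∧ cmConjRingHom L k = k ∧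
      (∀ w : {w : InfinitePlace L // IsComplex w},
        (0 < (w.1.embedding k).re ↔ 0 < ((((InfiniteAdeleRing.ringEquiv_mixedSpace L).toRingHom.comp (adeleFst L)) δ).2 w).re)) ∧
      δ = algebraMap L (AdeleRing (𝓞 L) L) k * (adeleConj L (z : AdeleRing (𝓞 L) L) * (z : AdeleRing (𝓞 L) L)) := by
  obtain ⟨k, z, hk0, hk, hδ⟩ := hδ
  exact ⟨k, z, hk0, hk, fun w => (re_snd_archProj_pos_iff L hk z.isUnit hδ w).symm, hδ⟩

end Literature.NumberTheory.Rogawski1990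

end
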